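import Mathlib
import Literature.NumberTheory.Transcendental.LandauDefectLatticeTate
import Summits.KontsevichZagierPeriods.KontsevichZagierPeriods.Theorems.InverseLandauInverseLandauRationalCurvesResidualVanishing

/-!
# Crux `InverseLandauRationalCurves`, line `Sketch` — kernel helpers, I: order transfer and traces

Helpers for the lead's stub `stub_kernel` (item stmt-KontsevichZagierPeriods-13872):

* `laurent_coeff_eq_zero_of_val_lt_one` — if an element `x ∈ k(ϖ)` has valuation `< 1` at some
  place of an extension `K ⊇ k(ϖ)` lying over `ϖ = 0`, then its Laurent expansion lies in
  `ϖ·k⟦ϖ⟧` (all coefficients of index `≤ 0` vanish).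
* `Landau.Place.precomp` — a place composed with a `k(ϖ)`-automorphism is a place (over `ϖ = 0` if
  the original one is).
* `laurent_coeff_trace_eq_zero` — **trace-and-order**: if `x ∈ K` has valuation `< 1` at EVERY
  place over `ϖ = 0` of the finite Galois extension `K/k(ϖ)`, then the Laurent expansion of
  `Tr_{K/k(ϖ)} x` lies in `ϖ·k⟦ϖ⟧`.
-/

noncomputable section

open Polynomial
open scoped LaurentSeries WithZero
open Literature.NumberTheory.Transcendental.AyoubRel

namespace Summit.KontsevichZagierPeriods.InverseLandau.RationalCurves

section OrderTransfer

variable {k : Type*} [Field k] {K : Type*} [Field K] [Algebra k K] [Algebra (RatFunc k) K]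
  [IsScalarTower k (RatFunc k) K]

/-- **Order transfer to the Laurent expansion.** If `x ∈ k(ϖ)` has valuation `< 1` at a place of
`K ⊇ k(ϖ)` over `ϖ = 0`, then all coefficients of index `≤ 0` of `x ∈ k((ϖ))` vanish. -/
theorem laurent_coeff_eq_zero_of_val_lt_one (c : Landau.Place k K)
    (hϖ : c.val (algebraMap (RatFunc k) K RatFunc.X) < 1) (x : RatFunc k)
    (hx : c.val (algebraMap (RatFunc k) K x) < 1) {n : ℤ} (hn : n ≤ 0) :
    (x : k⸨X⸩).coeff n = 0 := by
  classical
  -- `x = num / denom`; the numerator has zero constant term, the denominator does not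
  have hden0 : x.denom ≠ 0 := x.denom_ne_zero
  have hnum0 : x.num.coeff 0 = 0 := by
    by_contra h
    have h1 := residual_val_algebraMap_polynomial_eq_one c hϖ h
    have hd := residual_val_algebraMap_polynomial_le_one c hϖ.le x.denom
    have hxeq : x * algebraMap _ _ x.denom = algebraMap _ _ x.num :=
      ((div_eq_iff ((map_ne_zero_iff _ (IsFractionRing.injective k[X] (RatFunc k))).2 hden0)).1
        (RatFunc.num_div_denom x)).symm
    have hv := congrArg (fun y => c.val (algebraMap (RatFunc k) K y)) hxeq
    simp only [map_mul, h1] at hv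
    have hlt : c.val (algebraMap (RatFunc k) K x) *
        c.val (algebraMap (RatFunc k) K (algebraMap k[X] (RatFunc k) x.denom)) < 1 :=
      calc _ ≤ c.val (algebraMap (RatFunc k) K x) * 1 := by gcongr
        _ < 1 := by rw [mul_one]; exact hx
    rw [hv] at hlt
    exact lt_irrefl _ hlt
  have hXnum : (X : k[X]) ∣ x.num := by rw [X_dvd_iff]; exact hnum0
  have hden : x.denom.coeff 0 ≠ 0 := by
    intro h
    have hXden : (X : k[X]) ∣ x.denom := by rw [X_dvd_iff]; exact h
    have hcop := RatFunc.isCoprime_num_denom x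
    exact Polynomial.not_isUnit_X (hcop.isUnit_of_dvd' hXnum hXden)
  -- valuation of the Laurent expansion
  have hval : Valued.v (x : k⸨X⸩) ≤ WithZero.exp (-(1 : ℤ)) := by
    have e := RatFunc.valuation_eq_LaurentSeries_valuation (K := k) x
    rw [LaurentSeries.valuation_def, ← e]
    change (Polynomial.idealX k).valuation (RatFunc k) x ≤ WithZero.exp (-(1 : ℤ))
    conv_lhs => rw [← RatFunc.num_div_denom x]
    rw [map_div₀, IsDedekindDomain.HeightOneSpectrum.valuation_of_algebraMap,
      IsDedekindDomain.HeightOneSpectrum.valuation_of_algebraMap]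
    have hd1 : (Polynomial.idealX k).intValuation x.denom = 1 := by
      rw [IsDedekindDomain.HeightOneSpectrum.intValuation_eq_one_iff]
      rw [Polynomial.idealX_span, Ideal.mem_span_singleton, X_dvd_iff]
      exact hden
    have hn1 : (Polynomial.idealX k).intValuation x.num < 1 := by
      rw [IsDedekindDomain.HeightOneSpectrum.intValuation_lt_one_iff_dvd, Polynomial.idealX_span,
        Ideal.dvd_span_singleton, Ideal.mem_span_singleton]
      exact hXnum
    rw [hd1, div_one]
    have h1 : (WithZero.exp (-(1 : ℤ)) : ℤᵐ⁰) * WithZero.exp 1 = 1 := by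
      rw [← WithZero.exp_add]; simp
    rw [← h1] at hn1
    exact (WithZero.lt_mul_exp_iff_le WithZero.exp_ne_zero).1 hn1
  exact LaurentSeries.coeff_zero_of_lt_valuation k (D := 1) hval (by omega)

end OrderTransfer

section Trace

variable {k : Type*} [Field k] {K : Type*} [Field K] [Algebra k K] [Algebra (RatFunc k) K]
  [IsScalarTower k (RatFunc k) K]

/-- A place precomposed with a `k(ϖ)`-automorphism `σ` is again a place, and it lies over `ϖ = 0`
when the original one does; hence a bound valid at all places over `ϖ = 0` is valid for `σ x` at
any one of them. -/
theorem val_algEquiv_lt_one (c : Landau.Place k K)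
    (hϖ : c.val (algebraMap (RatFunc k) K RatFunc.X) < 1) (σ : K ≃ₐ[RatFunc k] K) (x : K)
    (hx : ∀ c' : Landau.Place k K, c'.val (algebraMap (RatFunc k) K RatFunc.X) < 1 → c'.val x < 1) :
    c.val (σ x) < 1 := by
  haveI := c.isTrivialOn
  -- the place `c ∘ σ`
  let v : Valuation K ℤᵐ⁰ := c.val.comap (σ : K →+* K)
  have hv : ∀ y, v y = c.val (σ y) := fun y => rfl
  haveI htriv : v.IsTrivialOn k := ⟨fun a ha => by
    rw [hv, IsScalarTower.algebraMap_apply k (RatFunc k) K, AlgEquiv.commutes]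
    rw [← IsScalarTower.algebraMap_apply]
    exact Valuation.IsTrivialOn.eq_one _ ha⟩
  let c' : Landau.Place k K :=
    { val := v
      surjective := fun γ => by
        obtain ⟨y, hy⟩ := c.surjective γ
        exact ⟨σ.symm y, by rw [hv, AlgEquiv.apply_symm_apply, hy]⟩
      isTrivialOn := htriv }
  have h1 : c'.val (algebraMap (RatFunc k) K RatFunc.X) < 1 := by
    change v _ < 1
    rw [hv, AlgEquiv.commutes]
    exact hϖ
  have h2 := hx c' h1
  exact h2

/-- **Trace-and-order.** In a finite Galois extension `K/k(ϖ)` possessing a place over `ϖ = 0`, an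
element whose valuation is `< 1` at EVERY place over `ϖ = 0` has a trace whose Laurent expansion
lies in `ϖ·k⟦ϖ⟧`: `Tr x = Σ_σ σx`, each `σx` has valuation `< 1` at the chosen place (the place
`c ∘ σ` is again over `ϖ = 0`), and the order transfers to `k((ϖ))`. -/
theorem laurent_coeff_trace_eq_zero [FiniteDimensional (RatFunc k) K] [IsGalois (RatFunc k) K]
    (hex : ∃ c : Landau.Place k K, c.val (algebraMap (RatFunc k) K RatFunc.X) < 1) (x : K)
    (hx : ∀ c : Landau.Place k K, c.val (algebraMap (RatFunc k) K RatFunc.X) < 1 → c.val x < 1)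
    {n : ℤ} (hn : n ≤ 0) :
    ((Algebra.trace (RatFunc k) K x : RatFunc k) : k⸨X⸩).coeff n = 0 := by
  obtain ⟨c, hc⟩ := hex
  refine laurent_coeff_eq_zero_of_val_lt_one c hc _ ?_ hn
  rw [trace_eq_sum_automorphisms]
  refine Valuation.map_sum_lt _ one_ne_zero fun σ _ => ?_
  exact val_algEquiv_lt_one c hc σ x hx

end Trace

/-- **Registered sub-goal `kernel_base_pack`** (packaging for the gate): trace-and-order. -/
theorem kernel_base_pack : ∀ {k : Type*} [Field k] {K : Type*} [Field K] [Algebra k K]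
    [Algebra (RatFunc k) K] [IsScalarTower k (RatFunc k) K] [FiniteDimensional (RatFunc k) K]
    [IsGalois (RatFunc k) K]
    (_ : ∃ c : Literature.NumberTheory.Transcendental.AyoubRel.Landau.Place k K,
      c.val (algebraMap (RatFunc k) K RatFunc.X) < 1)
    (x : K)
    (_ : ∀ c : Literature.NumberTheory.Transcendental.AyoubRel.Landau.Place k K,
      c.val (algebraMap (RatFunc k) K RatFunc.X) < 1 → c.val x < 1)
    {n : ℤ} (_ : n ≤ 0),
    ((Algebra.trace (RatFunc k) K x : RatFunc k) : LaurentSeries k).coeff n = 0 :=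
  fun hex x hx _ hn => laurent_coeff_trace_eq_zero hex x hx hn

end Summit.KontsevichZagierPeriods.InverseLandau.RationalCurves

end
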